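import Literature.Analysis.FluidPDE.StationaryEulerWeakFlows
import Literature.Analysis.FluidPDE.StationaryEulerLaminatesHighDim
import Literature.Analysis.FluidPDE.StationaryEulerPlanarFamily
import HarnessLib

/-!
# Proof of the `h`-principle for weak stationary Euler flows (Choffrut–Székelyhidi 2014, Thm. 1)

Topic `Literature/Analysis/FluidPDE`. Discharge of the named fact
`Literature.Analysis.FluidPDE.Torus.ChoffrutSzekelyhidi2014_thm1` (Choffrut–Székelyhidi, *Weak
solutions to the stationary incompressible Euler equations*, SIAM J. Math. Anal. 46 (2014)
4060–4074 = arXiv:1401.4301, Theorem 1), assembling the support files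
`StationaryEuler*.lean`: the relaxed family is `int 𝒦_r^{co}` with explicit laminates for `d ≥ 3`
(§4, `HighDim.relaxedFamily`) and `𝒱_r^{lc}` for `d = 2` (§5, `TwoDim.relaxedFamily`); §2
(Steps 1–3 with the explicit iteration in place of Baire category, and Lemma 2) then yields, for
every `n`, `n` pairwise not a.e. equal bounded weak stationary flows with `|v|² = e` a.e. and
`‖v - v₀‖_{H⁻¹} < σ` (`StationaryEuler.exists_weakFlows`).

## References

* A. Choffrut, L. Székelyhidi Jr., SIAM J. Math. Anal. 46 (2014), no. 6, 4060–4074;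
  arXiv:1401.4301, Theorem 1. [ChoffrutSzekelyhidi2014]
-/

noncomputable section

open scoped InnerProductSpace ENNReal
open MeasureTheory
open Literature.Analysis.FunctionSpaces

namespace Literature.Analysis.FluidPDE

namespace StationaryEuler

/-- The relaxed family in every dimension `d ≥ 2`. [cite: ChoffrutSzekelyhidi2014, §4 (d ≥ 3), §5 (d = 2)] -/
def relaxedFamilyOfCard {d : Type*} [Fintype d] [DecidableEq d] [Nonempty d] (h2 : 2 ≤ Fintype.card d) :
    RelaxedFamily d :=
  if h3 : 3 ≤ Fintype.card d then HighDim.relaxedFamily h3 else TwoDim.relaxedFamily (by omega)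

end StationaryEuler

namespace Torus

/-- **Choffrut–Székelyhidi 2014, Theorem 1, proved.** [cite: ChoffrutSzekelyhidi2014, Thm. 1] -/
theorem ChoffrutSzekelyhidi2014_thm1_holds : ChoffrutSzekelyhidi2014_thm1 := by
  intro d _ _ hd v₀ p₀ e hv hp hdiv hE he hlt σ hσ n
  haveI : Nonempty d := Fintype.card_pos_iff.1 (by omega)
  obtain ⟨v, hdist, hv'⟩ := StationaryEuler.exists_weakFlows (StationaryEuler.relaxedFamilyOfCard hd)
    hv hp hdiv hE he.continuous hlt hσ n
  exact ⟨v, hdist, fun i => ⟨(hv' i).1.1, (hv' i).1.2.1, (hv' i).1.2.2.1, (hv' i).1.2.2.2, (hv' i).2⟩⟩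

end Torus

end Literature.Analysis.FluidPDE
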